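import Summits.QuantumFields.BalabanUV.T4Continuum.Support.NE7EJTorusFourier

/-!
# NE7EJTorusMultiplier — row NE7 (node U5), candidate route HOM, variant H1L-EJ, item EJ-1b′ (T1)–(T3′): FOURIER MULTIPLIERS on the torus
# `(ℤ∕M)²` — the functional calculus `h(K)` of the plaquette Laplacian `K = −Δ_plaq` as a multiplier, its Parseval form
# `M²·Re⟨F, h(K)F⟩ = Σ_p h(ω(p))‖F̂(p)‖²` (MONOTONE in `h` on `[0,8]`), composition, reality on real fields, and THE RESOLVENT
# `(c + K)·[c(c+K)⁻¹] = c` — the operator behind THEOREM B's weight `g_B(K) = 2(2+K)⁻¹`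

Lineage `b2b-balaban-t4-ne7-p2` (CRUX PROVER NE7 #2 = C-HOM°'s kernel hand), generation 82; file 129.  Imports file 123 `NE7EJTorusFourier` only (plane
waves `chi`, `fhat`, `parseval`, `inversion`, `sum_chi_mul_conj`, the plaquette Laplacian `lapP` with symbol `omegaC`, `omegaC_eq`, `gK ∕ fhat_gK`).

WHY (lens 1 = `t4-ne7-idea-1` gen 73, THEOREM B «EF^flat ≥ Hess²(2+Hess)⁻¹ ⇔ 4A†A ≤ 2(2−Δ_plaq)⁻¹»; gen 67 (A2) «EF^flat ≥ φ(Hess^flat) ⇔ 4A†A ≤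
g(−Δ_plaq)», `g = 1 − φ(x)∕x`): file 124 proved the master inequality for ONE polynomial weight `g(K) = 1 − ½K + ⅛K²` written out in position
space (`gK`).  THEOREM B's weight `2(2+K)⁻¹` and COROLLARY B1's Padé weights are NOT polynomials; the natural common language is the multiplier
calculus `h(K) := M⁻²Σ_p h(ω(p))F̂(p)χ_p` — in which EVERY admissible weight (file 130) is treated at once and the comparison of two profiles is the
pointwise comparison of their symbols on `[0,8]` (file 127).  THIS FILE (general `M ≥ 1`; [folklore] discrete Fourier analysis):
* §1 `mulOp m` (symbol `m : (ℤ∕M)² → ℂ`): **`fhat_mulOp`** (`(Op_m F)^ = m·F̂`), `eq_of_fhat_eq` (Fourier injectivity), `mulOp_one`, **`mulOp_mulOp`**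
  (composition = product of symbols), linearity in the symbol and in the field, **`lapP_eq_mulOp`** (`K = Op_ω`), **`form_mulOp`** (Parseval:
  `M²Σ_x conj F·Op_mF = Σ_p m(p)‖F̂(p)‖²`).
* §2 the real symbol `omegaR` (`ω(p) = 4sin²(θ₁∕2) + 4sin²(θ₂∕2) ∈ [0,8]`, `omegaC = ↑omegaR`), `chi_neg_left`, **`omegaC_neg`** ∕ `omegaR_neg` (evenness),
  `fhat_neg_of_real` (`F̂(−p) = conj F̂(p)` for real `F`).
* §3 the functional calculus **`fK h := Op_{h∘ω}`** («`h(K)`»): `fK_id` (`= K`), `fK_const`, `fK_comp` (`h(K)h′(K) = (hh′)(K)`), `fK_add ∕ fK_sub ∕ fK_smul`,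
  **`form_fK`** (`M²·Re Σ_x conj F·h(K)F = Σ_p h(ω(p))‖F̂(p)‖²`), **`form_fK_mono`** (`h ≤ h′` on `[0,8]` ⇒ `Re⟨F,h(K)F⟩ ≤ Re⟨F,h′(K)F⟩`),
  `form_fK_nonneg`, **`fK_conj`** (`h(K)F` is REAL when `F` is), `gK_eq_fK` (file 123's `gK` is `(1 − ½x + ⅛x²)(K)`).
* §4 THE RESOLVENT: for `c > 0`, **`fK_resolvent`** (`c·R_cF + K(R_cF) = c·F` with `R_c := (c∕(c+·))(K)`, i.e. `R_c = c(c+K)⁻¹`), **`fK_resolvent_unique`**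
  (any solution `G` of `cG + KG = cF` IS `R_cF`), `resolvent_symbol_pos ∕ _le_one`; THEOREM B's weight is `R_2 = g_B(K)` (`gB_symbol`).
Nothing here is specific to `M` even or to L = 2; files 130–131 use it at `M = 2N`.

HONEST FRAMING: [folklore] finite Fourier analysis (every statement is an identity or a termwise comparison of finite sums); no inequality of lens 1's
is proved here (that is files 130–131 with 117–118, 124–125, 127–128); her objects stay hers; nothing of Bałaban's instantiated; d = 2 flat toy level;
NOT a letter move (PRICING-NE7 v56 §413); T-50-10 honoured.  NE7 NOT PRINTED ∕ NOT PROVED; spine 0∕9; FIXED FINITE T⁴, rung (B)+1; NOT infinite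
volume, NOT mass gap, NOT Clay.  HONEST DEPENDENCY: continuum YM on T⁴ ⇐ BetaPertH ∧ nine spine estimates (0/9 proved); BetaPertH ⇐ (D1) ∧ (D4) ∧
CAP+tail; G-an2-4 gates asym, D1 and NE2/3/4.
-/

noncomputable section

open Finset Complex ZMod

namespace Summit.QuantumFields.BalabanUV.T4Continuum.NE7EJTorusMultiplier

open NE7EJTorusFourier

variable {M : ℕ} [NeZero M]

/-! ### §1 Fourier multipliers -/

/-- `M² ≠ 0` in `ℂ`. [folklore] -/
theorem Msq_ne_zero : ((M : ℂ) ^ 2) ≠ 0 := pow_ne_zero _ (Nat.cast_ne_zero.mpr (NeZero.ne M))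

/-- **the Fourier multiplier with symbol `m`**: `(Op_m F)(x) := M⁻²·Σ_p m(p)·F̂(p)·χ_p(x)`. [folklore] -/
def mulOp (m : XX M → ℂ) (F : XX M → ℂ) (x : XX M) : ℂ := ((M : ℂ) ^ 2)⁻¹ * ∑ p, m p * fhat F p * chi p x

/-- orthogonality in the first index: `Σ_x χ_p(x)·conj χ_q(x) = M²·[p = q]`. [folklore] -/
theorem sum_chi_mul_conj_left (p q : XX M) : ∑ x : XX M, chi p x * starRingEnd ℂ (chi q x) = if p = q then ((M : ℂ) ^ 2) else 0 := by
  simp_rw [chi_comm p, chi_comm q]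
  exact sum_chi_mul_conj p q

/-- **`(Op_m F)^(q) = m(q)·F̂(q)`**. [folklore] -/
theorem fhat_mulOp (m : XX M → ℂ) (F : XX M → ℂ) (q : XX M) : fhat (mulOp m F) q = m q * fhat F q := by
  have hM := Msq_ne_zero (M := M)
  show ∑ x, starRingEnd ℂ (chi q x) * (((M : ℂ) ^ 2)⁻¹ * ∑ p, m p * fhat F p * chi p x) = m q * fhat F q
  have e1 : ∀ x : XX M, starRingEnd ℂ (chi q x) * (((M : ℂ) ^ 2)⁻¹ * ∑ p, m p * fhat F p * chi p x)
      = ∑ p, ((M : ℂ) ^ 2)⁻¹ * (m p * fhat F p) * (chi p x * starRingEnd ℂ (chi q x)) := fun x => by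
    rw [mul_sum, mul_sum]
    exact sum_congr rfl fun p _ => by ring
  simp_rw [e1]
  rw [sum_comm]
  simp_rw [← mul_sum, sum_chi_mul_conj_left, mul_ite, mul_zero]
  rw [sum_ite_eq' univ q, if_pos (mem_univ _), mul_comm, ← mul_assoc, mul_inv_cancel₀ hM, one_mul]

/-- Fourier injectivity: equal coefficients ⇒ equal fields. [folklore] -/
theorem eq_of_fhat_eq {F G : XX M → ℂ} (h : ∀ p, fhat F p = fhat G p) : F = G := by
  funext x
  have hF := inversion F x
  have hG := inversion G x
  simp_rw [h] at hF
  rw [hF] at hG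
  exact mul_left_cancel₀ Msq_ne_zero hG

/-- `F̂` is additive. [folklore] -/
theorem fhat_add (F G : XX M → ℂ) (p : XX M) : fhat (fun x => F x + G x) p = fhat F p + fhat G p := by
  unfold fhat; rw [← sum_add_distrib]; exact sum_congr rfl fun x _ => by ring

/-- `F̂` is homogeneous. [folklore] -/
theorem fhat_const_mul (c : ℂ) (F : XX M → ℂ) (p : XX M) : fhat (fun x => c * F x) p = c * fhat F p := by
  unfold fhat; rw [mul_sum]; exact sum_congr rfl fun x _ => by ring

/-- `F̂` of a difference. [folklore] -/
theorem fhat_sub (F G : XX M → ℂ) (p : XX M) : fhat (fun x => F x - G x) p = fhat F p - fhat G p := by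
  unfold fhat; rw [← sum_sub_distrib]; exact sum_congr rfl fun x _ => by ring

/-- the trivial symbol: `Op_1 = id` (Fourier inversion). [folklore] -/
theorem mulOp_one (F : XX M → ℂ) : mulOp (fun _ => 1) F = F :=
  eq_of_fhat_eq fun p => by rw [fhat_mulOp, one_mul]

/-- **composition = product of symbols**: `Op_m(Op_{m′}F) = Op_{m·m′}F`. [folklore] -/
theorem mulOp_mulOp (m m' : XX M → ℂ) (F : XX M → ℂ) : mulOp m (mulOp m' F) = mulOp (fun p => m p * m' p) F :=
  eq_of_fhat_eq fun p => by rw [fhat_mulOp, fhat_mulOp, fhat_mulOp, mul_assoc]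

/-- multipliers commute. [folklore] -/
theorem mulOp_comm (m m' : XX M → ℂ) (F : XX M → ℂ) : mulOp m (mulOp m' F) = mulOp m' (mulOp m F) := by
  rw [mulOp_mulOp, mulOp_mulOp]; congr 1; funext p; ring

/-- additivity in the symbol. [folklore] -/
theorem mulOp_add_symbol (m m' : XX M → ℂ) (F : XX M → ℂ) :
    mulOp (fun p => m p + m' p) F = fun x => mulOp m F x + mulOp m' F x :=
  eq_of_fhat_eq fun p => by rw [fhat_mulOp, fhat_add, fhat_mulOp, fhat_mulOp]; ring

/-- subtraction in the symbol. [folklore] -/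
theorem mulOp_sub_symbol (m m' : XX M → ℂ) (F : XX M → ℂ) :
    mulOp (fun p => m p - m' p) F = fun x => mulOp m F x - mulOp m' F x :=
  eq_of_fhat_eq fun p => by rw [fhat_mulOp, fhat_sub, fhat_mulOp, fhat_mulOp]; ring

/-- homogeneity in the symbol. [folklore] -/
theorem mulOp_smul_symbol (c : ℂ) (m : XX M → ℂ) (F : XX M → ℂ) :
    mulOp (fun p => c * m p) F = fun x => c * mulOp m F x :=
  eq_of_fhat_eq fun p => by rw [fhat_mulOp, fhat_const_mul, fhat_mulOp]; ring

/-- additivity in the field. [folklore] -/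
theorem mulOp_add (m : XX M → ℂ) (F G : XX M → ℂ) :
    mulOp m (fun x => F x + G x) = fun x => mulOp m F x + mulOp m G x :=
  eq_of_fhat_eq fun p => by rw [fhat_mulOp, fhat_add, fhat_add, fhat_mulOp, fhat_mulOp]; ring

/-- homogeneity in the field. [folklore] -/
theorem mulOp_const_mul (m : XX M → ℂ) (c : ℂ) (F : XX M → ℂ) :
    mulOp m (fun x => c * F x) = fun x => c * mulOp m F x :=
  eq_of_fhat_eq fun p => by rw [fhat_mulOp, fhat_const_mul, fhat_const_mul, fhat_mulOp]; ring

/-- **the plaquette Laplacian is the multiplier with symbol `ω`**: `K = Op_ω`. [folklore] -/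
theorem lapP_eq_mulOp (F : XX M → ℂ) : lapP F = mulOp omegaC F :=
  eq_of_fhat_eq fun p => by rw [fhat_lapP, fhat_mulOp]

/-- **Parseval for a multiplier**: `M²·Σ_x conj(F x)·(Op_m F)(x) = Σ_p m(p)·‖F̂(p)‖²`. [folklore] -/
theorem form_mulOp (m : XX M → ℂ) (F : XX M → ℂ) :
    ((M : ℂ) ^ 2) * ∑ x, starRingEnd ℂ (F x) * mulOp m F x = ∑ p, m p * ((‖fhat F p‖ ^ 2 : ℝ) : ℂ) := by
  rw [← parseval]
  refine sum_congr rfl fun p _ => ?_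
  rw [fhat_mulOp]; push_cast; rw [← Complex.conj_mul']; ring

/-- the sesquilinear version: `M²·Σ_x conj(G x)·(Op_m F)(x) = Σ_p m(p)·conj Ĝ(p)·F̂(p)`. [folklore] -/
theorem form_mulOp₂ (m : XX M → ℂ) (F G : XX M → ℂ) :
    ((M : ℂ) ^ 2) * ∑ x, starRingEnd ℂ (G x) * mulOp m F x = ∑ p, m p * (starRingEnd ℂ (fhat G p) * fhat F p) := by
  rw [← parseval]
  refine sum_congr rfl fun p _ => ?_
  rw [fhat_mulOp]; ring

/-! ### §2 The real symbol `ω(p) ∈ [0,8]`, evenness, real fields -/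

/-- the real plaquette-Laplacian symbol `ω(p) = 4sin²(θ(p₁)∕2) + 4sin²(θ(p₂)∕2)`. [folklore] -/
def omegaR (p : XX M) : ℝ := 4 * Real.sin (ang p.1 / 2) ^ 2 + 4 * Real.sin (ang p.2 / 2) ^ 2

/-- `omegaC = ↑omegaR` (file 123's `omegaC_eq`). [folklore] -/
theorem omegaC_eq_omegaR (p : XX M) : omegaC p = ((omegaR p : ℝ) : ℂ) := omegaC_eq p

omit [NeZero M] in
/-- `0 ≤ ω(p)`. [folklore] -/
theorem omegaR_nonneg (p : XX M) : 0 ≤ omegaR p := by unfold omegaR; positivity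

omit [NeZero M] in
/-- `ω(p) ≤ 8` (the top of the plaquette-Laplacian spectrum in d = 2). [folklore] -/
theorem omegaR_le_eight (p : XX M) : omegaR p ≤ 8 := by
  unfold omegaR
  nlinarith [Real.sin_sq_le_one (ang p.1 / 2), Real.sin_sq_le_one (ang p.2 / 2)]
omit [NeZero M] in
/-- `ω(p)` lies in `[0,8]`. [folklore] -/
theorem omegaR_mem (p : XX M) : omegaR p ∈ Set.Icc (0:ℝ) 8 := ⟨omegaR_nonneg p, omegaR_le_eight p⟩

/-- `χ_{−p}(x) = χ_p(−x)`. [folklore] -/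
theorem chi_neg_left (p x : XX M) : chi (-p) x = chi p (-x) := by
  unfold chi; simp only [Prod.fst_neg, Prod.snd_neg, neg_mul, mul_neg]

/-- **evenness of the symbol**: `ω(−p) = ω(p)`. [folklore] -/
theorem omegaC_neg (p : XX M) : omegaC (-p) = omegaC p := by
  unfold omegaC
  rw [chi_neg_left, chi_neg_left, chi_neg_left, chi_neg_left, neg_neg, neg_neg]
  ring

/-- evenness of the real symbol. [folklore] -/
theorem omegaR_neg (p : XX M) : omegaR (-p) = omegaR p := by
  have h := omegaC_neg p
  rw [omegaC_eq_omegaR, omegaC_eq_omegaR] at h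
  exact_mod_cast h

/-- for a REAL field, `F̂(−p) = conj F̂(p)`. [folklore] -/
theorem fhat_neg_of_real (f : XX M → ℝ) (p : XX M) :
    fhat (fun x => ((f x : ℝ) : ℂ)) (-p) = starRingEnd ℂ (fhat (fun x => ((f x : ℝ) : ℂ)) p) := by
  unfold fhat
  rw [map_sum]
  refine sum_congr rfl fun x _ => ?_
  rw [map_mul, Complex.conj_ofReal, chi_neg_left, ← chi_conj, Complex.conj_conj]

/-! ### §3 The functional calculus `h(K)` of the plaquette Laplacian -/

/-- **`h(K) := Op_{h∘ω}`** — the multiplier with symbol `p ↦ h(ω(p))`. [folklore] -/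
def fK (h : ℝ → ℝ) (F : XX M → ℂ) : XX M → ℂ := mulOp (fun p => ((h (omegaR p) : ℝ) : ℂ)) F

/-- `(h(K)F)^(p) = h(ω(p))·F̂(p)`. [folklore] -/
theorem fhat_fK (h : ℝ → ℝ) (F : XX M → ℂ) (p : XX M) : fhat (fK h F) p = ((h (omegaR p) : ℝ) : ℂ) * fhat F p :=
  fhat_mulOp _ F p

/-- `id(K) = K`. [folklore] -/
theorem fK_id (F : XX M → ℂ) : fK (fun x => x) F = lapP F := by
  rw [lapP_eq_mulOp]; unfold fK; congr 1; funext p; rw [omegaC_eq_omegaR]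

/-- constants: `c(K) = c·id`. [folklore] -/
theorem fK_const (c : ℝ) (F : XX M → ℂ) : fK (fun _ => c) F = fun x => (c : ℂ) * F x := by
  unfold fK
  have h := mulOp_smul_symbol (c : ℂ) (fun _ => (1 : ℂ)) F
  simp only [mul_one] at h
  rw [h]; funext x; rw [mulOp_one]

/-- `1(K) = id`. [folklore] -/
theorem fK_one (F : XX M → ℂ) : fK (fun _ => 1) F = F := by
  rw [fK_const]; funext x; push_cast; ring

/-- **`h(K)∘h′(K) = (h·h′)(K)`**. [folklore] -/
theorem fK_comp (h h' : ℝ → ℝ) (F : XX M → ℂ) : fK h (fK h' F) = fK (fun x => h x * h' x) F := by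
  unfold fK; rw [mulOp_mulOp]; congr 1; funext p; push_cast; ring

/-- the calculus is commutative. [folklore] -/
theorem fK_comm (h h' : ℝ → ℝ) (F : XX M → ℂ) : fK h (fK h' F) = fK h' (fK h F) := by
  rw [fK_comp, fK_comp]; congr 1; funext x; ring

/-- `(h + h′)(K) = h(K) + h′(K)`. [folklore] -/
theorem fK_add (h h' : ℝ → ℝ) (F : XX M → ℂ) : fK (fun x => h x + h' x) F = fun y => fK h F y + fK h' F y := by
  unfold fK; rw [← mulOp_add_symbol]; congr 1; funext p; push_cast; ring

/-- `(h − h′)(K) = h(K) − h′(K)`. [folklore] -/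
theorem fK_sub (h h' : ℝ → ℝ) (F : XX M → ℂ) : fK (fun x => h x - h' x) F = fun y => fK h F y - fK h' F y := by
  unfold fK; rw [← mulOp_sub_symbol]; congr 1; funext p; push_cast; ring

/-- `(c·h)(K) = c·h(K)`. [folklore] -/
theorem fK_smul (c : ℝ) (h : ℝ → ℝ) (F : XX M → ℂ) : fK (fun x => c * h x) F = fun y => (c : ℂ) * fK h F y := by
  unfold fK; rw [← mulOp_smul_symbol]; congr 1; funext p; push_cast; ring

/-- `h(K)` is additive in the field. [folklore] -/
theorem fK_add_field (h : ℝ → ℝ) (F G : XX M → ℂ) : fK h (fun x => F x + G x) = fun y => fK h F y + fK h G y := by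
  unfold fK; rw [mulOp_add]

/-- `h(K)` applied after `K`: `h(K)(KF) = (x·h)(K)F`. [folklore] -/
theorem fK_lapP (h : ℝ → ℝ) (F : XX M → ℂ) : fK h (lapP F) = fK (fun x => x * h x) F := by
  rw [← fK_id, fK_comp]; congr 1; funext x; ring

/-- `K` applied after `h(K)`. [folklore] -/
theorem lapP_fK (h : ℝ → ℝ) (F : XX M → ℂ) : lapP (fK h F) = fK (fun x => x * h x) F := by
  rw [← fK_id, fK_comp]

/-- **PARSEVAL FOR `h(K)`**: `M²·Re Σ_x conj(F x)·(h(K)F)(x) = Σ_p h(ω(p))·‖F̂(p)‖²` (and the imaginary part vanishes). [folklore] -/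
theorem form_fK (h : ℝ → ℝ) (F : XX M → ℂ) :
    ((M : ℝ) ^ 2) * (∑ x, starRingEnd ℂ (F x) * fK h F x).re = ∑ p, h (omegaR p) * ‖fhat F p‖ ^ 2 := by
  have hc := form_mulOp (fun p => ((h (omegaR p) : ℝ) : ℂ)) F
  simp_rw [← Complex.ofReal_mul] at hc
  rw [← Complex.ofReal_sum] at hc
  have hre := congrArg Complex.re hc
  rw [show ((M : ℂ) ^ 2) = (((M : ℝ) ^ 2 : ℝ) : ℂ) by push_cast; ring, Complex.re_ofReal_mul, Complex.ofReal_re] at hre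
  exact hre

/-- the complex form itself is real: `M²·Σ_x conj(F x)·(h(K)F)(x) = ↑(Σ_p h(ω(p))‖F̂(p)‖²)`. [folklore] -/
theorem form_fK_complex (h : ℝ → ℝ) (F : XX M → ℂ) :
    ((M : ℂ) ^ 2) * ∑ x, starRingEnd ℂ (F x) * fK h F x = ((∑ p, h (omegaR p) * ‖fhat F p‖ ^ 2 : ℝ) : ℂ) := by
  have hc := form_mulOp (fun p => ((h (omegaR p) : ℝ) : ℂ)) F
  simp_rw [← Complex.ofReal_mul] at hc
  rw [← Complex.ofReal_sum] at hc
  exact hc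

/-- **MONOTONICITY IN THE PROFILE**: if `h ≤ h′` on `[0,8]` then `Re⟨F, h(K)F⟩ ≤ Re⟨F, h′(K)F⟩` for every field `F`. [folklore] -/
theorem form_fK_mono {h h' : ℝ → ℝ} (hle : ∀ x, 0 ≤ x → x ≤ 8 → h x ≤ h' x) (F : XX M → ℂ) :
    (∑ x, starRingEnd ℂ (F x) * fK h F x).re ≤ (∑ x, starRingEnd ℂ (F x) * fK h' F x).re := by
  have hM : (0 : ℝ) < (M : ℝ) ^ 2 := by
    have : (0 : ℝ) < M := by exact_mod_cast Nat.pos_of_ne_zero (NeZero.ne M)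
    positivity
  refine le_of_mul_le_mul_left ?_ hM
  rw [form_fK, form_fK]
  exact sum_le_sum fun p _ => mul_le_mul_of_nonneg_right (hle _ (omegaR_nonneg p) (omegaR_le_eight p)) (sq_nonneg _)

/-- positivity: `0 ≤ h` on `[0,8]` ⇒ `0 ≤ Re⟨F, h(K)F⟩`. [folklore] -/
theorem form_fK_nonneg {h : ℝ → ℝ} (hnn : ∀ x, 0 ≤ x → x ≤ 8 → 0 ≤ h x) (F : XX M → ℂ) :
    0 ≤ (∑ x, starRingEnd ℂ (F x) * fK h F x).re := by
  have hM : (0 : ℝ) < (M : ℝ) ^ 2 := by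
    have : (0 : ℝ) < M := by exact_mod_cast Nat.pos_of_ne_zero (NeZero.ne M)
    positivity
  have hf := form_fK h F
  have hs : 0 ≤ ∑ p, h (omegaR p) * ‖fhat F p‖ ^ 2 :=
    sum_nonneg fun p _ => mul_nonneg (hnn _ (omegaR_nonneg p) (omegaR_le_eight p)) (sq_nonneg _)
  rw [← hf] at hs
  have h0 : ((M : ℝ) ^ 2) * 0 ≤ ((M : ℝ) ^ 2) * (∑ x, starRingEnd ℂ (F x) * fK h F x).re := by rw [mul_zero]; exact hs
  exact le_of_mul_le_mul_left h0 hM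

/-- only the values of the profile on `[0,8]` matter. [folklore] -/
theorem fK_congr {h h' : ℝ → ℝ} (heq : ∀ x, 0 ≤ x → x ≤ 8 → h x = h' x) (F : XX M → ℂ) : fK h F = fK h' F := by
  unfold fK; congr 1; funext p; rw [heq _ (omegaR_nonneg p) (omegaR_le_eight p)]

/-- **REALITY**: on a real field `F = ↑f`, `h(K)F` is real — `conj (h(K)F)(x) = (h(K)F)(x)`. [folklore] -/
theorem fK_conj (h : ℝ → ℝ) (f : XX M → ℝ) (x : XX M) :
    starRingEnd ℂ (fK h (fun y => ((f y : ℝ) : ℂ)) x) = fK h (fun y => ((f y : ℝ) : ℂ)) x := by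
  unfold fK mulOp
  rw [map_mul, map_inv₀, map_pow, Complex.conj_natCast, map_sum]
  congr 1
  -- conj(h(ω p) F̂(p) χ_p(x)) = h(ω(−p)) F̂(−p) χ_{−p}(x); reindex p ↦ −p
  rw [← Equiv.sum_comp (Equiv.neg (XX M))]
  refine sum_congr rfl fun p _ => ?_
  simp only [Equiv.neg_apply, map_mul, Complex.conj_ofReal]
  rw [omegaR_neg, fhat_neg_of_real, chi_neg_left, ← chi_conj, Complex.conj_conj, Complex.conj_conj]

/-- equivalently its imaginary part vanishes. [folklore] -/
theorem fK_im_eq_zero (h : ℝ → ℝ) (f : XX M → ℝ) (x : XX M) : (fK h (fun y => ((f y : ℝ) : ℂ)) x).im = 0 := by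
  have := fK_conj h f x
  exact Complex.conj_eq_iff_im.mp this

/-- so `h(K)F = ↑(Re h(K)F)` on real fields. [folklore] -/
theorem fK_eq_ofReal_re (h : ℝ → ℝ) (f : XX M → ℝ) (x : XX M) :
    fK h (fun y => ((f y : ℝ) : ℂ)) x = (((fK h (fun y => ((f y : ℝ) : ℂ)) x).re : ℝ) : ℂ) := by
  apply Complex.ext
  · rw [Complex.ofReal_re]
  · rw [Complex.ofReal_im]; exact fK_im_eq_zero h f x

/-- docking to file 123: its `g(K) = 1 − ½K + ⅛K²` IS `(1 − ½x + ⅛x²)(K)`. [folklore] -/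
theorem gK_eq_fK (N : ℕ) [NeZero N] (F : XX (2 * N) → ℂ) :
    gK N F = fK (fun x => 1 - (1 / 2) * x + (1 / 8) * x ^ 2) F :=
  eq_of_fhat_eq fun p => by
    rw [fhat_gK, fhat_fK, omegaC_eq_omegaR]; push_cast; ring

/-! ### §4 THE RESOLVENT `c(c + K)⁻¹ = (c∕(c+·))(K)` -/

/-- the resolvent profile `r_c(x) := c∕(c + x)` (`r_2 = g_B` of file 127). [folklore] -/
def resProfile (c x : ℝ) : ℝ := c / (c + x)

/-- `0 < r_c ≤ 1` on `x ≥ 0` for `c > 0`. [folklore] -/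
theorem resProfile_pos {c x : ℝ} (hc : 0 < c) (hx : 0 ≤ x) : 0 < resProfile c x := by
  unfold resProfile; positivity

/-- `r_c ≤ 1` on `x ≥ 0` for `c > 0`. [folklore] -/
theorem resProfile_le_one {c x : ℝ} (hc : 0 < c) (hx : 0 ≤ x) : resProfile c x ≤ 1 := by
  unfold resProfile; rw [div_le_one (by linarith)]; linarith

/-- the defining identity of the profile: `(c + x)·r_c(x) = c` for `c + x ≠ 0`. [folklore] -/
theorem add_mul_resProfile {c x : ℝ} (h : c + x ≠ 0) : (c + x) * resProfile c x = c := by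
  unfold resProfile; field_simp

/-- **THE RESOLVENT IDENTITY**: for `c > 0` and `R_c := r_c(K)`, `c·(R_cF) + K(R_cF) = c·F` — i.e. `R_c = c(c + K)⁻¹`. [folklore] -/
theorem fK_resolvent {c : ℝ} (hc : 0 < c) (F : XX M → ℂ) :
    (fun x => (c : ℂ) * fK (resProfile c) F x + lapP (fK (resProfile c) F) x) = fun x => (c : ℂ) * F x := by
  refine eq_of_fhat_eq fun p => ?_
  rw [fhat_add, fhat_const_mul, fhat_lapP, fhat_fK, fhat_const_mul, omegaC_eq_omegaR]
  have h : (c + omegaR p) * resProfile c (omegaR p) = c := add_mul_resProfile (by linarith [omegaR_nonneg p])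
  have hC : ((c : ℂ) + ((omegaR p : ℝ) : ℂ)) * ((resProfile c (omegaR p) : ℝ) : ℂ) = (c : ℂ) := by exact_mod_cast h
  linear_combination (fhat F p) * hC

/-- **UNIQUENESS**: for `c > 0`, any `G` with `cG + KG = cF` IS `R_cF` (so `(c + K)` is invertible and `R_c` is `c` times its inverse).
[folklore] -/
theorem fK_resolvent_unique {c : ℝ} (hc : 0 < c) {F G : XX M → ℂ}
    (hG : ∀ x, (c : ℂ) * G x + lapP G x = (c : ℂ) * F x) : G = fK (resProfile c) F := by
  refine eq_of_fhat_eq fun p => ?_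
  have h : fhat (fun x => (c : ℂ) * G x + lapP G x) p = fhat (fun x => (c : ℂ) * F x) p := by rw [funext hG]
  rw [fhat_add, fhat_const_mul, fhat_lapP, fhat_const_mul, omegaC_eq_omegaR, ← add_mul] at h
  rw [fhat_fK]
  have hne : ((c : ℂ) + ((omegaR p : ℝ) : ℂ)) ≠ 0 := by
    rw [← Complex.ofReal_add]; exact_mod_cast (by linarith [omegaR_nonneg p] : c + omegaR p ≠ 0)
  have hr : ((resProfile c (omegaR p) : ℝ) : ℂ) = (c : ℂ) / ((c : ℂ) + ((omegaR p : ℝ) : ℂ)) := by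
    show ((c / (c + omegaR p) : ℝ) : ℂ) = _
    rw [Complex.ofReal_div, Complex.ofReal_add]
  rw [hr, div_mul_eq_mul_div, eq_div_iff hne]
  linear_combination h

/-- THEOREM B's weight is the resolvent at `c = 2`: `r_2 = g_B = 2∕(2+x)` (file 127's `gB`, restated pointwise to keep this file's imports
minimal). [folklore] -/
theorem resProfile_two (x : ℝ) : resProfile 2 x = 2 / (2 + x) := rfl

/-- and `1 − r_2(x) = x∕(2+x)` (`= ψ_B`) for `x ≥ 0`. [folklore] -/
theorem one_sub_resProfile_two {x : ℝ} (hx : 0 ≤ x) : 1 - resProfile 2 x = x / (2 + x) := by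
  unfold resProfile; field_simp; ring

end Summit.QuantumFields.BalabanUV.T4Continuum.NE7EJTorusMultiplier

end
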